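import Summits.Ventures.PercRepro.Night2FatXFreePointGeom

/-!
# night-2: the nested extreme — `W ∖ {x}` inside one line, generic off-points

When all of `W ∖ {x}` lies on one line of `V` (the nested-line geometries of the census), no target above `Q ∪ {x}` is
loaded once the off-points are generic: a distance-1 load needs `rk (G ∖ T) ≥ 3` while `G ∖ T ⊆ W ∖ {x}` has rank `≤ 2`,
and a distance-2 load needs a line coplanar with `w₀, x` (`dload_eq_zero_of_collinear_of_generic`).  So
`basis_pair_fair_fat_of_unloaded` applies: **`basis_pair_fair_fat_of_collinear_of_generic`** — the pair's fair share
whenever `rk (W ∖ {x}) ≤ 2`.  Paper `proofs/NIGHT-2-g33.md` §6 (b).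
-/

namespace PercRepro.Shadow

open PercRepro.ThmH PercRepro.PerFlat

variable {α : Type*} [DecidableEq α] {M : Matroid α} [M.Finite] {G : Finset α}

/-- **With `W ∖ {x}` of rank `≤ 2` and generic off-points nothing above `Q ∪ {x}` is loaded.** -/
theorem dload_eq_zero_of_collinear_of_generic (hG : G ∈ flatsQ M (5 + 1)) (hd : (gr M \ G).card = 2)
    (hk : kColoops M G = 1) (hs : ∀ e ∈ gr M, ∀ f ∈ gr M, e ≠ f → rkN M {e, f} = 2)
    (hl : ∀ e ∈ gr M, M.Indep {e}) (hfat : (fatClosures M 5 G 2).card ≤ 1) {B₀ : Finset α}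
    (hB₀ : B₀ ∈ thinMembers M 5 G) {w₀ x : α} (hD : G \ clF M B₀ = {w₀, x})
    (hgen : ∀ R ⊆ G \ coloops M G, rkN M R = 2 → 3 ≤ R.card → 4 ≤ rkN M (insert w₀ (insert x R)))
    {B : Finset α} {z : α} (hcol : rkN M ((G \ insert z B).erase x) ≤ 2) {T : Finset α}
    (hT : T ∈ tgtSets M 5 G B z) (hxT : x ∈ T) :
    dload M 5 G (bigP M G) (dshGT2 M 5 G) T = 0 := by
  by_contra hload
  have hTG : T ⊆ G := subset_G_of_mem_shadowAt (mem_tgtSets.1 hT).1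
  have hQT : insert z B ⊆ T := (mem_tgtSets.1 hT).2.1
  obtain ⟨R, hR, hR2, hR3, hcase⟩ := loaded_fat_target_dichotomy hG hd hk hs hl hfat hB₀ hD hTG hload
  rcases hcase with ⟨-, hrk⟩ | ⟨-, hcop⟩
  · have hsub : G \ T ⊆ (G \ insert z B).erase x := by
      intro e he
      rw [Finset.mem_sdiff] at he
      exact Finset.mem_erase.2 ⟨fun h' => he.2 (h' ▸ hxT), Finset.mem_sdiff.2 ⟨he.1, fun h' => he.2 (hQT h')⟩⟩
    have := rkN_mono (M := M) hsub
    omega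
  · have hRV : R ⊆ G \ coloops M G := fun r hr =>
      Finset.sdiff_subset_sdiff hTG (Finset.Subset.refl _) (Finset.mem_sdiff.1 (hR hr)).1
    have := hgen R hRV hR2 hR3
    omega

/-- **The fat case of (FAIR) with generic off-points when `W ∖ {x}` lies on a line.** -/
theorem basis_pair_fair_fat_of_collinear_of_generic (hG : G ∈ flatsQ M (5 + 1)) (hd : (gr M \ G).card = 2)
    (hk : kColoops M G = 1) (hs : ∀ e ∈ gr M, ∀ f ∈ gr M, e ≠ f → rkN M {e, f} = 2)
    (hl : ∀ e ∈ gr M, M.Indep {e}) (hfat : (fatClosures M 5 G 2).card ≤ 1)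
    {B₀ : Finset α} (hB₀ : B₀ ∈ thinMembers M 5 G) {w₀ x : α} (hD : G \ clF M B₀ = {w₀, x}) (hne : w₀ ≠ x)
    (hgen : ∀ R ⊆ G \ coloops M G, rkN M R = 2 → 3 ≤ R.card → 4 ≤ rkN M (insert w₀ (insert x R)))
    {B : Finset α} (hB : B ∈ thinMembers M 5 G) (hnP : ¬ bigP M G B) {z : α} (hz : z ∈ G \ clF M B)
    (hl0 : loss M 5 G B z ≠ 0) (hw₀ : w₀ ∈ insert z B) (hx : x ∉ insert z B)
    (hcol : rkN M ((G \ insert z B).erase x) ≤ 2) :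
    loss M 5 G B z ≤ rhoL M 5 G B z * lossIncomeH M 5 G (bigP M G) (dshGT2 M 5 G) B z :=
  basis_pair_fair_fat_of_unloaded hG hd hk hs hl hfat hB₀ hD hne hB hnP hz hl0 hw₀ hx
    (fun _ hT hxT => dload_eq_zero_of_collinear_of_generic hG hd hk hs hl hfat hB₀ hD hgen hcol hT hxT)

end PercRepro.Shadow
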